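import Literature.Probability.Percolation.KSTPeriodicNoSubpath
import Literature.Probability.Percolation.KSTPeriodicSymmetry
import HarnessLib

/-!
# KST-type RSW for periodic measures: Lemma 4, the corridor step

Topic `Literature/Probability/Percolation`. Second half of the combinatorics of
[KohlerSchindlerTassion2023, Lemma 4]: on `𝓔 ∩ 𝓠(l, j)` the corridor lemma `CorridorB` forces
one of two `kℤ²`-translates of the bridge event `𝓑(l)` (`noSubpath_inter_quasi_subset`), plus the
measurability of quasi-crossings and the two-event square-root trick used by the inequality
(`KSTPeriodicCascadeStep.lean`).

## References

* [KohlerSchindlerTassion2023] L. Köhler-Schindler, V. Tassion, *Crossing probabilities for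
  planar percolation*, Duke Math. J. 172 (2023), §4.4, Lemma 4, §4.2 Lemma 2; Comment 1.
-/

namespace Literature.Probability.Percolation

open LatticeModels SimpleGraph _root_.MeasureTheory

noncomputable section

namespace KSTPeriodic

/-! ### Part 2: `𝓔 ∩ 𝓠(l, j)` forces a translated bridge -/

/-- **Part 2 of Lemma 4** (the corridor step): for a lattice configuration in `𝓔 ∩ 𝓠(l, j)`
(`0 < j ≤ l`, `j, l ∈ 12kℤ`, `t ≤ k`), writing `l = 12kc`, one of the two translates of the
bridge event `𝓑(l)` by `∓k(2c + 1) e₀ = ∓(2b + k) e₀` occurs: by `CorridorB` the witness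
`l`-path of `𝓔` meets a wall-with-connector of `𝓠(l, j)`, so its top end (in the upper target of
`H_l`) is joined inside `S_l` to a side column of `S_l`, and `openConnIn_left_box` /
`openConnIn_right_box` cut out a crossing of the translated box `H_l ∓ (2b + k) e₀` between its
left and right parts. [cite: KohlerSchindlerTassion2023, Lemma 4 (second display) and Lemma 2] -/
theorem noSubpath_inter_quasi_subset {ω : BondConfig (Site 2)} (hω : ω ⊆ (zdGraph 2).edgeSet)
    {k t l j c : ℕ} (hk : 1 ≤ k) (htk : t ≤ k) (hj : 0 < j) (hjl : j ≤ l) (h12j : 12 * k ∣ j)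
    (hl : l = 12 * k * c) (hCo : CorridorB)
    (hE : ∃ (p q : Site 2) (P : (zdGraph 2).Walk p q),
        (p ∈ upperTarget t (l / 12) l ∧ q ∈ upperTarget t (l / 12) (-(l : ℤ) - t) ∧
          (∀ x ∈ P.support, x ∈ mRegion t (l / 12) l) ∧
          ¬ ∃ (p' q' : Site 2) (κ : (zdGraph 2).Walk p' q'),
            p' ∈ upperTarget t (j / 12) j ∧ q' ∈ upperTarget t (j / 12) (-(j : ℤ) - t) ∧
            (∀ x ∈ κ.support, x ∈ mRegion t (j / 12) j) ∧ ∀ e ∈ κ.edges, e ∈ P.edges) ∧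
        ∀ e ∈ P.edges, e ∈ ω)
    (hQ : ω ∈ quasi t (l / 4 + k) l (j / 12) j) :
    ω ∈ openCrossing (Site.shift ((k : ℤ) • ![-(2 * (c : ℤ) + 1), 0]) '' mRegion t (l / 12) l)
        (Site.shift ((k : ℤ) • ![-(2 * (c : ℤ) + 1), 0]) '' leftPart t (l / 12) l)
        (Site.shift ((k : ℤ) • ![-(2 * (c : ℤ) + 1), 0]) '' rightPart t (l / 12) l) ∨
      ω ∈ openCrossing (Site.shift ((k : ℤ) • ![2 * (c : ℤ) + 1, 0]) '' mRegion t (l / 12) l)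
        (Site.shift ((k : ℤ) • ![2 * (c : ℤ) + 1, 0]) '' leftPart t (l / 12) l)
        (Site.shift ((k : ℤ) • ![2 * (c : ℤ) + 1, 0]) '' rightPart t (l / 12) l) := by
  classical
  -- arithmetic of the scales
  obtain ⟨c', hc'⟩ := h12j
  have hb : l / 12 = k * c := by
    rw [hl, mul_assoc, Nat.mul_div_cancel_left _ (by norm_num)]
  have hw : l / 4 = 3 * (k * c) := by
    rw [hl, show 12 * k * c = 4 * (3 * (k * c)) by ring, Nat.mul_div_cancel_left _ (by norm_num)]
  have hbj : j / 12 = k * c' := by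
    rw [hc', mul_assoc, Nat.mul_div_cancel_left _ (by norm_num)]
  have hjZ : (j : ℤ) = 12 * ((k * c' : ℕ) : ℤ) := by rw [hc']; push_cast; ring
  have hlZ : (l : ℤ) = 12 * ((k * c : ℕ) : ℤ) := by rw [hl]; push_cast; ring
  have hW : ((3 * (k * c) + k : ℕ) : ℤ) = 3 * ((k * c : ℕ) : ℤ) + k := by push_cast; ring
  have hBk : (k : ℤ) ≤ ((k * c : ℕ) : ℤ) := by
    have hc1 : 1 ≤ c := by
      rcases Nat.eq_zero_or_pos c with h | h
      · subst h; simp at hl; omega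
      · exact h
    exact_mod_cast (Nat.le_mul_of_pos_right k hc1)
  have hBk' : (k : ℤ) ≤ ((k * c' : ℕ) : ℤ) := by
    have hc1 : 1 ≤ c' := by
      rcases Nat.eq_zero_or_pos c' with h | h
      · subst h; simp at hc'; omega
      · exact h
    exact_mod_cast (Nat.le_mul_of_pos_right k hc1)
  have hk1 : (1 : ℤ) ≤ k := by exact_mod_cast hk
  have hjl' : (j : ℤ) ≤ l := by exact_mod_cast hjl
  have htk' : (t : ℤ) ≤ k := by exact_mod_cast htk
  have hj' : (0 : ℤ) < j := by exact_mod_cast hj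
  have ht0 : (0 : ℤ) ≤ t := by exact_mod_cast t.zero_le
  have hsmulL : ∀ x : Site 2, (x - (k : ℤ) • ![-(2 * (c : ℤ) + 1), 0]) 0 = x 0 + 2 * ((k * c : ℕ) : ℤ) + k ∧
      (x - (k : ℤ) • ![-(2 * (c : ℤ) + 1), 0]) 1 = x 1 := by
    intro x; push_cast; simp only [Pi.sub_apply, Pi.smul_apply, smul_eq_mul,
      Matrix.cons_val_zero, Matrix.cons_val_one]; constructor <;> ring
  have hsmulR : ∀ x : Site 2, (x - (k : ℤ) • ![2 * (c : ℤ) + 1, 0]) 0 = x 0 - 2 * ((k * c : ℕ) : ℤ) - k ∧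
      (x - (k : ℤ) • ![2 * (c : ℤ) + 1, 0]) 1 = x 1 := by
    intro x; push_cast; simp only [Pi.sub_apply, Pi.smul_apply, smul_eq_mul,
      Matrix.cons_val_zero, Matrix.cons_val_one]; constructor <;> ring
  simp only [hb, hw, hbj] at hE hQ ⊢
  -- the data
  obtain ⟨p, q, P, ⟨hp, hq, hPS, hnoκ⟩, hPω⟩ := hE
  obtain ⟨⟨z₁, hM₁, e₁, he₁S, he₁c, hc₁⟩, ⟨z₂, hM₂, e₂, he₂S, he₂c, hc₂⟩⟩ := hQ
  obtain ⟨g₁, h₁, γ₁, hg₁, hh₁, hγ₁S, hγ₁ω, hz₁⟩ := exists_walk_of_mPathAt hω hM₁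
  obtain ⟨g₂, h₂, γ₂, hg₂, hh₂, hγ₂S, hγ₂ω, hz₂⟩ := exists_walk_of_mPathAt hω hM₂
  obtain ⟨ζ₁, hζ₁S, hζ₁ω⟩ := exists_walk_of_mem_openConnIn hω hc₁
  obtain ⟨ζ₂, hζ₂S, hζ₂ω⟩ := exists_walk_of_mem_openConnIn hω hc₂
  rw [mem_upperTarget] at hp hq hg₁ hh₁ hg₂ hh₂
  rw [mem_rect] at he₁S he₂S
  -- `P` inside the big box `S_l`
  have hPS' : ∀ x ∈ P.support, -((l : ℤ) + ((3 * (k * c) + k : ℕ) : ℤ)) - t ≤ x 0 ∧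
      x 0 ≤ l + ((3 * (k * c) + k : ℕ) : ℤ) ∧ -(l : ℤ) - t ≤ x 1 ∧ x 1 ≤ l := by
    intro x hx
    have h := hPS x hx
    rw [mRegion, mem_rect] at h
    refine ⟨?_, ?_, h.2.2.1, h.2.2.2⟩ <;> linarith [h.1, h.2.1]
  have hHjS : mRegion t (k * c') j ⊆ rect (-((l : ℤ) + ((3 * (k * c) + k : ℕ) : ℤ)) - t)
      (l + ((3 * (k * c) + k : ℕ) : ℤ)) (-(l : ℤ) - t) l := by
    intro x hx
    rw [mRegion, mem_rect] at hx
    rw [mem_rect]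
    refine ⟨?_, ?_, ?_, ?_⟩ <;> linarith [hx.1, hx.2.1, hx.2.2.1, hx.2.2.2]
  -- `P` meets one of the walls-with-connectors (else `CorridorB` produces a `j`-sub-walk)
  have hmeet : ∃ z ∈ P.support,
      z ∈ γ₁.support ∨ z ∈ ζ₁.support ∨ z ∈ γ₂.support ∨ z ∈ ζ₂.support := by
    by_contra hcon
    push Not at hcon
    apply hnoκ
    have hCo' := hCo (-((l : ℤ) + ((3 * (k * c) + k : ℕ) : ℤ)) - t) (l + ((3 * (k * c) + k : ℕ) : ℤ))
      (-(l : ℤ) - t) l (-((j : ℤ) + ((k * c' : ℕ) : ℤ)) - t) (j + ((k * c' : ℕ) : ℤ))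
      (-(j : ℤ) - t) j (-((k * c' : ℕ) : ℤ) - t) ((k * c' : ℕ) : ℤ)
      (by linarith) (by linarith) (by linarith) hjl'
      (by linarith) (by linarith) (by linarith) (by linarith)
      p q P hPS' hp.2.2 hq.2.2
      g₁ h₁ γ₁ (fun z hz => hγ₁S z hz) hg₁ hh₁ z₁ e₁ ζ₁ (fun z hz => hζ₁S z hz) hz₁ he₁c
      g₂ h₂ γ₂ (fun z hz => hγ₂S z hz) hg₂ hh₂ z₂ e₂ ζ₂ (fun z hz => hζ₂S z hz) hz₂ he₂c
      (fun z hz => ⟨(hcon z hz).1, (hcon z hz).2.1, (hcon z hz).2.2.1, (hcon z hz).2.2.2⟩)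
    obtain ⟨p', q', κ, hp', hq', hκS, hκP⟩ := hCo'
    exact ⟨p', q', κ, hp', hq', hκS, hκP⟩
  obtain ⟨z, hzP, hz⟩ := hmeet
  -- `p` is joined inside `S_l` to `z`
  have hpz : ω ∈ openConnIn (rect (-((l : ℤ) + ((3 * (k * c) + k : ℕ) : ℤ)) - t)
      (l + ((3 * (k * c) + k : ℕ) : ℤ)) (-(l : ℤ) - t) l) p z :=
    mem_openConnIn_of_mem_support P (fun x hx => hPS' x hx) hPω hzP
  -- conclusion from a connection of `p` to the left column …
  have goalL : ω ∈ openConnIn (rect (-((l : ℤ) + ((3 * (k * c) + k : ℕ) : ℤ)) - t)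
      (l + ((3 * (k * c) + k : ℕ) : ℤ)) (-(l : ℤ) - t) l) p e₁ →
      ω ∈ openCrossing (Site.shift ((k : ℤ) • ![-(2 * (c : ℤ) + 1), 0]) '' mRegion t (k * c) l)
        (Site.shift ((k : ℤ) • ![-(2 * (c : ℤ) + 1), 0]) '' leftPart t (k * c) l)
        (Site.shift ((k : ℤ) • ![-(2 * (c : ℤ) + 1), 0]) '' rightPart t (k * c) l) := by
    intro hpe
    obtain ⟨y, hy, hyS, hey⟩ := openConnIn_left_box hω (X := (l : ℤ) - ((k * c : ℕ) : ℤ) - k)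
      (by linarith) he₁c hpe
    rw [mem_rect] at hyS
    refine ⟨e₁, ?_, y, ?_, openConnIn_mono ?_ _ _ hey⟩
    · rw [mem_image_shift_iff, leftPart, Set.mem_setOf_eq, mem_rect, (hsmulL e₁).1, (hsmulL e₁).2]
      refine ⟨⟨by linarith, by linarith, he₁S.2.2.1, he₁S.2.2.2⟩, Or.inl (by linarith)⟩
    · rw [mem_image_shift_iff, rightPart, Set.mem_setOf_eq, mem_rect, (hsmulL y).1, (hsmulL y).2]
      rcases hy with rfl | hy
      · exact ⟨⟨by linarith, by linarith, by linarith, hp.2.2.le⟩, Or.inr ⟨Or.inl hp.2.2, by linarith⟩⟩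
      · exact ⟨⟨by linarith, by linarith, hyS.2.2.1, hyS.2.2.2⟩, Or.inl (by linarith)⟩
    · intro x hx
      rw [mem_rect] at hx
      rw [mem_image_shift_iff, mRegion, mem_rect, (hsmulL x).1, (hsmulL x).2]
      exact ⟨by linarith, by linarith, hx.2.2.1, hx.2.2.2⟩
  -- … and from a connection of `p` to the right column
  have goalR : ω ∈ openConnIn (rect (-((l : ℤ) + ((3 * (k * c) + k : ℕ) : ℤ)) - t)
      (l + ((3 * (k * c) + k : ℕ) : ℤ)) (-(l : ℤ) - t) l) p e₂ →
      ω ∈ openCrossing (Site.shift ((k : ℤ) • ![2 * (c : ℤ) + 1, 0]) '' mRegion t (k * c) l)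
        (Site.shift ((k : ℤ) • ![2 * (c : ℤ) + 1, 0]) '' leftPart t (k * c) l)
        (Site.shift ((k : ℤ) • ![2 * (c : ℤ) + 1, 0]) '' rightPart t (k * c) l) := by
    intro hpe
    obtain ⟨y, hy, hyS, hey⟩ := openConnIn_right_box hω (X := -(l : ℤ) + ((k * c : ℕ) : ℤ) + k - t)
      (by linarith) he₂c hpe
    rw [mem_rect] at hyS
    refine ⟨y, ?_, e₂, ?_, openConnIn_mono ?_ _ _ (by rwa [openConnIn_comm])⟩
    · rw [mem_image_shift_iff, leftPart, Set.mem_setOf_eq, mem_rect, (hsmulR y).1, (hsmulR y).2]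
      rcases hy with rfl | hy
      · exact ⟨⟨by linarith, by linarith, by linarith, hp.2.2.le⟩, Or.inr ⟨Or.inl hp.2.2, by linarith⟩⟩
      · exact ⟨⟨by linarith, by linarith, hyS.2.2.1, hyS.2.2.2⟩, Or.inl (by linarith)⟩
    · rw [mem_image_shift_iff, rightPart, Set.mem_setOf_eq, mem_rect, (hsmulR e₂).1, (hsmulR e₂).2]
      refine ⟨⟨by linarith, by linarith, he₂S.2.2.1, he₂S.2.2.2⟩, Or.inl (by linarith)⟩
    · intro x hx
      rw [mem_rect] at hx
      rw [mem_image_shift_iff, mRegion, mem_rect, (hsmulR x).1, (hsmulR x).2]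
      exact ⟨by linarith, by linarith, hx.2.2.1, hx.2.2.2⟩
  -- the four cases
  rcases hz with hz | hz | hz | hz
  · -- `z` on the left wall `γ₁`: along `γ₁` to its anchor `z₁`, then along `ζ₁`
    refine Or.inl (goalL (PlanarDuality.openConnIn_trans hpz ?_))
    have h1 : ω ∈ openConnIn (mRegion t (k * c') j) g₁ z :=
      mem_openConnIn_of_mem_support γ₁ hγ₁S hγ₁ω hz
    have h2 : ω ∈ openConnIn (mRegion t (k * c') j) g₁ z₁ :=
      mem_openConnIn_of_mem_support γ₁ hγ₁S hγ₁ω hz₁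
    rw [openConnIn_comm] at h1
    exact PlanarDuality.openConnIn_trans
      (openConnIn_mono hHjS _ _ (PlanarDuality.openConnIn_trans h1 h2)) hc₁
  · -- `z` on the left connector `ζ₁`
    refine Or.inl (goalL (PlanarDuality.openConnIn_trans hpz ?_))
    have h1 : ω ∈ openConnIn _ z₁ z := mem_openConnIn_of_mem_support ζ₁ hζ₁S hζ₁ω hz
    rw [openConnIn_comm] at h1
    exact PlanarDuality.openConnIn_trans h1 hc₁
  · -- `z` on the right wall `γ₂`
    refine Or.inr (goalR (PlanarDuality.openConnIn_trans hpz ?_))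
    have h1 : ω ∈ openConnIn (mRegion t (k * c') j) g₂ z :=
      mem_openConnIn_of_mem_support γ₂ hγ₂S hγ₂ω hz
    have h2 : ω ∈ openConnIn (mRegion t (k * c') j) g₂ z₂ :=
      mem_openConnIn_of_mem_support γ₂ hγ₂S hγ₂ω hz₂
    rw [openConnIn_comm] at h1
    exact PlanarDuality.openConnIn_trans
      (openConnIn_mono hHjS _ _ (PlanarDuality.openConnIn_trans h1 h2)) hc₂
  · -- `z` on the right connector `ζ₂`
    refine Or.inr (goalR (PlanarDuality.openConnIn_trans hpz ?_))
    have h1 : ω ∈ openConnIn _ z₂ z := mem_openConnIn_of_mem_support ζ₂ hζ₂S hζ₂ω hz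
    rw [openConnIn_comm] at h1
    exact PlanarDuality.openConnIn_trans h1 hc₂

/-! ### Measurability of quasi-crossings -/

/-- The event "`z` lies on an open `m`-path" is measurable. [folklore] -/
theorem measurableSet_mPathAt (t b m : ℕ) (z : Site 2) :
    MeasurableSet {ω : BondConfig (Site 2) | MPathAt t b m ω z} := by
  have h : {ω : BondConfig (Site 2) | MPathAt t b m ω z} =
      (⋃ u ∈ upperTarget t b m, (openConnIn (mRegion t b m) z u : Set (BondConfig (Site 2)))) ∩
        ⋃ v ∈ upperTarget t b (-(m : ℤ) - t), (openConnIn (mRegion t b m) z v : Set (BondConfig (Site 2))) := by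
    ext ω
    simp only [MPathAt, Set.mem_setOf_eq, Set.mem_inter_iff, Set.mem_iUnion, exists_prop]
  rw [h]
  exact (MeasurableSet.biUnion (Set.to_countable _) fun u _ =>
    measurableSet_openConnIn_of_countable _ _ _).inter
    (MeasurableSet.biUnion (Set.to_countable _) fun v _ => measurableSet_openConnIn_of_countable _ _ _)

/-- The left half quasi-crossing is measurable. [folklore] -/
theorem measurableSet_quasiLeft (t w n b m : ℕ) : MeasurableSet (quasiLeft t w n b m) := by
  have h : quasiLeft t w n b m = ⋃ z : Site 2, {ω : BondConfig (Site 2) | MPathAt t b m ω z} ∩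
      ⋃ l ∈ {l : Site 2 | l ∈ rect (-((n : ℤ) + w) - t) (n + w) (-(n : ℤ) - t) n ∧
        l 0 = -((n : ℤ) + w) - t},
        (openConnIn (rect (-((n : ℤ) + w) - t) (n + w) (-(n : ℤ) - t) n) z l : Set (BondConfig (Site 2))) := by
    ext ω
    simp only [quasiLeft, Set.mem_setOf_eq, Set.mem_iUnion, Set.mem_inter_iff, exists_prop, and_assoc]
  rw [h]
  exact MeasurableSet.iUnion fun z => (measurableSet_mPathAt t b m z).inter
    (MeasurableSet.biUnion (Set.to_countable _) fun l _ => measurableSet_openConnIn_of_countable _ _ _)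

/-- The right half quasi-crossing is measurable. [folklore] -/
theorem measurableSet_quasiRight (t w n b m : ℕ) : MeasurableSet (quasiRight t w n b m) := by
  have h : quasiRight t w n b m = ⋃ z : Site 2, {ω : BondConfig (Site 2) | MPathAt t b m ω z} ∩
      ⋃ r ∈ {r : Site 2 | r ∈ rect (-((n : ℤ) + w) - t) (n + w) (-(n : ℤ) - t) n ∧ r 0 = (n : ℤ) + w},
        (openConnIn (rect (-((n : ℤ) + w) - t) (n + w) (-(n : ℤ) - t) n) z r : Set (BondConfig (Site 2))) := by
    ext ω
    simp only [quasiRight, Set.mem_setOf_eq, Set.mem_iUnion, Set.mem_inter_iff, exists_prop, and_assoc]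
  rw [h]
  exact MeasurableSet.iUnion fun z => (measurableSet_mPathAt t b m z).inter
    (MeasurableSet.biUnion (Set.to_countable _) fun l _ => measurableSet_openConnIn_of_countable _ _ _)

/-- Quasi-crossings are measurable. [folklore] -/
theorem measurableSet_quasi (t w n b m : ℕ) : MeasurableSet (quasi t w n b m) :=
  (measurableSet_quasiLeft t w n b m).inter (measurableSet_quasiRight t w n b m)

/-! ### Tools for the cascading inequality -/

/-- Monotonicity of real measures under an almost sure inclusion. [folklore] -/
theorem measureReal_mono_of_ae {μ : Measure (BondConfig (Site 2))} [IsFiniteMeasure μ]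
    {A B : Set (BondConfig (Site 2))} (h : ∀ᵐ ω ∂μ, ω ∈ A → ω ∈ B) : μ.real A ≤ μ.real B := by
  rw [measureReal_def, measureReal_def]
  exact ENNReal.toReal_mono (measure_ne_top _ _) (measure_mono_ae h)

/-- The two-event square-root trick: for increasing `A, B`,
`(1 - μ A)(1 - μ B) ≤ 1 - μ(A ∪ B)` (the decreasing complements are positively correlated).
[cite: KohlerSchindlerTassion2023, §1 Positive association] -/
theorem one_sub_mul_one_sub_le {k t : ℕ} {μ : Measure (BondConfig (Site 2))} [IsProbabilityMeasure μ]
    (hμ : Admissible k t μ) {A B : Set (BondConfig (Site 2))} (hA : IsUpperSet A) (hB : IsUpperSet B)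
    (hAm : MeasurableSet A) (hBm : MeasurableSet B) :
    (1 - μ.real A) * (1 - μ.real B) ≤ 1 - μ.real (A ∪ B) := by
  have h := hμ.posAssoc.lowerSet hA.compl hB.compl hAm.compl hBm.compl
  have h' : μ.real Aᶜ * μ.real Bᶜ ≤ μ.real (Aᶜ ∩ Bᶜ) := by
    rw [measureReal_def, measureReal_def, measureReal_def, ← ENNReal.toReal_mul]
    exact ENNReal.toReal_mono (measure_ne_top μ _) h
  rwa [← Set.compl_union, probReal_compl_eq_one_sub hAm, probReal_compl_eq_one_sub hBm,
    probReal_compl_eq_one_sub (hAm.union hBm)] at h'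

end KSTPeriodic

end

end Literature.Probability.Percolation
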